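import Mathlib
import HarnessLib

/-!
# Flat base change for `Ext` (change of rings `A → R`), def-free packaging

Crux `HomologicalConductor.Persistence` (stmt-ResolutionOfSingularities-16484), chain W4.4b; pool object
**W4.4b U1 = THEOREM A in Lean**, FILE 1a (res-L1-w44b-plan-1 UNCLAIMED-STUB LIST 08:48:32Z / CUT
08:51:41Z; source `L/res-L1-w44b-stub-3/THEOREM-A.md` c2177413955d684d, §1: «`E_m = Extᵐ_A(M, N) =
Extᵐ_R(M[u], N)`»). `[OURS · L1 w44b]` — folklore homological algebra (Cartan–Eilenberg change of
rings), NOT a statement of the manuscript under review in cell res-hironaka and using none of its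
statements; AI-written, weaker than expert review.

For a ring map `f : A →+* R` of commutative rings write `F = ModuleCat.extendScalars f` (`X ↦ R ⊗_A X`)
and `G = ModuleCat.restrictScalars f` (`N ↦ N|_A`); `Ext` is Mathlib's `CategoryTheory.Abelian.Ext` in
`ModuleCat`, as in `Literature/RingTheory/CohomologyAnnihilator/Basic.lean`.

* `extendScalars_additive`, `extendScalars_preservesProjectiveObjects`, `extendScalars_map_smul_id` —
  bookkeeping: for `f` flat, `F` is additive (it is exact); `F` preserves projectives (left adjoint of
  the epi-preserving `G`); `F (c • 𝟙 X) = f c • 𝟙 (F X)`.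
* **`exists_extBaseChange`** — for `f` FLAT, every `R`-module `N` and every degree `n` there is a family
  of additive BIJECTIONS `Φ_X : Extⁿ_A(X, G N) → Extⁿ_R(F X, N)` (namely
  `e ↦ (F e) ∘ (counit : F G N → N)`, Mathlib's `Ext.mapExactFunctor`), with `Φ (c • e) = f c • Φ e`,
  natural in `X` (precomposition with `A`-linear maps) and in `N` (postcomposition with
  `R`-endomorphisms of `N`). Bijectivity: degree `0` is the adjunction `F ⊣ G`; the inductive step is
  dimension shifting over a projective presentation `0 → K → P → X → 0` in `ModuleCat A` (it stays
  short exact under the exact functor `F`, `F P` is projective) and the five lemma — the argument of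
  Mathlib's `Functor.mapExt_bijective_of_preservesProjectiveObjects`, with the counit inserted.
  Packaged as an `∃` (no new definitions).
* **`smul_ext_eq_zero_of_flat_baseChange`** — the annihilator transfer the chain uses: if `c : A`
  kills `Extⁿ_A(X, N|_A)` then `f c` kills `Extⁿ_R(R ⊗_A X, N)`.
* `smul_ext_eq_zero_of_iso₁` / `smul_ext_eq_zero_of_iso₂` — annihilation of `Ext` is invariant under
  isomorphisms of either argument (any linear abelian category).
* Bridges to the `[Algebra A R]` / `[IsScalarTower A R N]` vocabulary: `nonempty_iso_restrictScalars`
  (`ModuleCat.of A N ≅ G (ModuleCat.of R N)`, the identity) and `nonempty_iso_extendScalars`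
  (`ModuleCat.of R (R ⊗[A] X) ≅ F (ModuleCat.of A X)`, the identity on pure tensors); whence
  **`smul_ext_eq_zero_of_flat`**: for `R` a flat `A`-algebra, `c` kills
  `Extⁿ_A(X, (ModuleCat.of R N)|_A)` ⇒ `algebraMap A R c` kills `Extⁿ_R(R ⊗[A] X, N)`.

The relative sequence `0 → A[X] ⊗_A M → A[X] ⊗_A M → M → 0` and THEOREM A's exponent-two corollary
live in the sibling file `HomologicalConductorPersistenceRelativeSequence.lean`.
-/

-- single-problem summit: the doubled namespace component is forced
set_option linter.dupNamespace false

noncomputable section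

open CategoryTheory CategoryTheory.Abelian CategoryTheory.Limits
open scoped TensorProduct

universe u

namespace Summit.ResolutionOfSingularities.ResolutionOfSingularities.Theorems.HomologicalConductor.PersistenceExtFlatBaseChange

/-! ## Annihilation of `Ext` is invariant under isomorphisms -/

section Iso

universe w t v u'

variable {R₀ : Type t} [Ring R₀] {C : Type u'} [Category.{v} C] [Abelian C] [Linear R₀ C]
  [HasExt.{w} C]

/-- If `X ≅ X'` and `c` kills `Extⁿ(X', N)` then `c` kills `Extⁿ(X, N)`. [folklore] -/
theorem smul_ext_eq_zero_of_iso₁ {X X' N : C} (ι : X ≅ X') {n : ℕ} {c : R₀}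
    (h : ∀ e : Ext X' N n, c • e = 0) (e : Ext X N n) : c • e = 0 := by
  have he : e = (Ext.mk₀ ι.hom).comp ((Ext.mk₀ ι.inv).comp e (zero_add n)) (zero_add n) := by
    rw [← Ext.comp_assoc_of_second_deg_zero, Ext.mk₀_comp_mk₀, ι.hom_inv_id, Ext.mk₀_id_comp]
  rw [he, ← Ext.comp_smul, h, Ext.comp_zero]

/-- If `N ≅ N'` and `c` kills `Extⁿ(X, N')` then `c` kills `Extⁿ(X, N)`. [folklore] -/
theorem smul_ext_eq_zero_of_iso₂ {X N N' : C} (ι : N ≅ N') {n : ℕ} {c : R₀}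
    (h : ∀ e : Ext X N' n, c • e = 0) (e : Ext X N n) : c • e = 0 := by
  have he : e = (e.comp (Ext.mk₀ ι.hom) (add_zero n)).comp (Ext.mk₀ ι.inv) (add_zero n) := by
    rw [Ext.comp_assoc_of_third_deg_zero, Ext.mk₀_comp_mk₀, ι.hom_inv_id, Ext.comp_mk₀_id]
  rw [he, ← Ext.smul_comp, h, Ext.zero_comp]

end Iso

/-! ## Flat base change -/

section BaseChange

variable {A R : Type u} [CommRing A] [CommRing R] (f : A →+* R)

/-- For a flat ring map `f`, `extendScalars f` is additive (it preserves binary products).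
[folklore] -/
theorem extendScalars_additive (hf : f.Flat) : (ModuleCat.extendScalars.{u, u, u} f).Additive := by
  haveI : PreservesFiniteLimits (ModuleCat.extendScalars.{u, u, u} f) :=
    ModuleCat.preservesFiniteLimits_extendScalars_of_flat hf
  exact Functor.additive_of_preserves_binary_products _

/-- `extendScalars f` preserves projective objects (left adjoint of the epi-preserving
`restrictScalars f`). [folklore] -/
theorem extendScalars_preservesProjectiveObjects :
    (ModuleCat.extendScalars.{u, u, u} f).PreservesProjectiveObjects :=
  Functor.preservesProjectiveObjects_of_adjunction_of_preservesEpimorphisms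
    (ModuleCat.extendRestrictScalarsAdj f)

set_option backward.isDefEq.respectTransparency false in
/-- The homothety `c • 𝟙 X` of an `A`-module base-changes to the homothety `f c • 𝟙` of `R ⊗_A X`.
[folklore] -/
theorem extendScalars_map_smul_id (X : ModuleCat.{u} A) (c : A) :
    (ModuleCat.extendScalars.{u, u, u} f).map (c • 𝟙 X) =
      f c • 𝟙 ((ModuleCat.extendScalars.{u, u, u} f).obj X) := by
  apply ModuleCat.hom_ext
  refine LinearMap.ext fun z => ?_
  induction z using TensorProduct.induction_on with
  | zero => rw [map_zero, map_zero]
  | tmul s x => exact (TensorProduct.smul_tmul c s x).symm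
  | add z w hz hw => rw [map_add, map_add, hz, hw]

/-- **Flat base change for `Ext`** (def-free packaging). For a flat ring map `f : A → R`, an
`A`-module `X` and an `R`-module `N` there is, in every degree `n`, an additive bijection
`Φ : Extⁿ_A(X, N|_A) ≃ Extⁿ_R(R ⊗_A X, N)` — namely `e ↦ (R ⊗_A e) ∘ (counit : R ⊗_A N|_A → N)` —
compatible with the scalar actions (`Φ (c • e) = f c • Φ e`), natural in `X` (precomposition with
`A`-linear maps `g`, which become `R ⊗_A g`) and natural in `N` (postcomposition with `R`-linear
endomorphisms `g` of `N`, seen on the left through `g|_A`). Inside the proof `Φ` is also shown to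
commute with the connecting maps of short exact sequences in `X` (they stay short exact under the
exact functor `R ⊗_A −`), which drives the dimension-shifting induction. [folklore: Cartan–Eilenberg
change of rings; the proof is Mathlib's `Ext.mapExactFunctor` plus the five lemma over projective
presentations] -/
theorem exists_extBaseChange (hf : f.Flat) (N : ModuleCat.{u} R) (n : ℕ) :
    ∃ Φ : ∀ X : ModuleCat.{u} A,
        Ext.{u} X ((ModuleCat.restrictScalars.{u, u, u} f).obj N) n →+
          Ext.{u} ((ModuleCat.extendScalars.{u, u, u} f).obj X) N n,
      (∀ X, Function.Bijective (Φ X)) ∧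
      (∀ X (c : A) (e : Ext X ((ModuleCat.restrictScalars f).obj N) n),
        Φ X (c • e) = f c • Φ X e) ∧
      (∀ (X Y : ModuleCat.{u} A) (g : X ⟶ Y) (e : Ext Y ((ModuleCat.restrictScalars f).obj N) n),
        Φ X ((Ext.mk₀ g).comp e (zero_add n)) =
          (Ext.mk₀ ((ModuleCat.extendScalars f).map g)).comp (Φ Y e) (zero_add n)) ∧
      (∀ X (g : N ⟶ N) (e : Ext X ((ModuleCat.restrictScalars f).obj N) n),
        Φ X (e.comp (Ext.mk₀ ((ModuleCat.restrictScalars f).map g)) (add_zero n)) =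
          (Φ X e).comp (Ext.mk₀ g) (add_zero n)) := by
  haveI := extendScalars_additive f hf
  haveI : PreservesFiniteLimits (ModuleCat.extendScalars.{u, u, u} f) :=
    ModuleCat.preservesFiniteLimits_extendScalars_of_flat hf
  haveI := extendScalars_preservesProjectiveObjects f
  let F := ModuleCat.extendScalars.{u, u, u} f
  let adj := ModuleCat.extendRestrictScalarsAdj.{u, u, u} f
  let ε : F.obj ((ModuleCat.restrictScalars.{u, u, u} f).obj N) ⟶ N := adj.counit.app N
  -- the comparison map, in every degree and for every `X`
  let Φ : ∀ (k : ℕ) (X : ModuleCat.{u} A),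
      Ext.{u} X ((ModuleCat.restrictScalars.{u, u, u} f).obj N) k →+ Ext.{u} (F.obj X) N k :=
    fun k X => AddMonoidHom.mk' (fun e => (e.mapExactFunctor F).comp (Ext.mk₀ ε) (add_zero k))
      (fun e₁ e₂ => by rw [Ext.mapExactFunctor_add, Ext.add_comp])
  have hΦ : ∀ k X (e : Ext.{u} X ((ModuleCat.restrictScalars.{u, u, u} f).obj N) k),
      Φ k X e = (e.mapExactFunctor F).comp (Ext.mk₀ ε) (add_zero k) := fun _ _ _ => rfl
  -- naturality in `X`
  have hnat : ∀ k (X Y : ModuleCat.{u} A) (g : X ⟶ Y)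
      (e : Ext Y ((ModuleCat.restrictScalars f).obj N) k),
      Φ k X ((Ext.mk₀ g).comp e (zero_add k)) =
        (Ext.mk₀ (F.map g)).comp (Φ k Y e) (zero_add k) := by
    intro k X Y g e
    rw [hΦ, hΦ, Ext.mapExactFunctor_comp, Ext.mapExactFunctor_mk₀, Ext.comp_assoc_of_third_deg_zero]
  -- compatibility with connecting maps
  have hδ : ∀ {S : ShortComplex (ModuleCat.{u} A)} (hS : S.ShortExact) (k : ℕ)
      (e : Ext S.X₁ ((ModuleCat.restrictScalars f).obj N) k),
      Φ (k + 1) S.X₃ (hS.extClass.comp e (add_comm 1 k)) =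
        (hS.map_of_exact F).extClass.comp (Φ k S.X₁ e) (add_comm 1 k) := by
    intro S hS k e
    rw [hΦ, hΦ, Ext.mapExactFunctor_comp, Ext.mapExactFunctor_extClass,
      Ext.comp_assoc_of_third_deg_zero]
    rfl
  -- degree `0`: `Φ (mk₀ g) = mk₀ (adj.homEquiv.symm g)`
  have h0 : ∀ (X : ModuleCat.{u} A) (g : X ⟶ (ModuleCat.restrictScalars.{u, u, u} f).obj N),
      Φ 0 X (Ext.mk₀ g) = Ext.mk₀ ((adj.homEquiv X N).symm g) := by
    intro X g
    rw [hΦ, Ext.mapExactFunctor_mk₀, Ext.mk₀_comp_mk₀, Adjunction.homEquiv_counit]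
  -- bijectivity in every degree, by dimension shifting over a projective presentation of `X`
  have hbij : ∀ k X, Function.Bijective (Φ k X) := by
    intro k
    induction k with
    | zero =>
      intro X
      constructor
      · intro e₁ e₂ h
        obtain ⟨g₁, rfl⟩ := (Ext.mk₀_bijective _ _).2 e₁
        obtain ⟨g₂, rfl⟩ := (Ext.mk₀_bijective _ _).2 e₂
        rw [h0, h0] at h
        rw [(adj.homEquiv X N).symm.injective ((Ext.mk₀_bijective _ _).1 h)]
      · intro e'
        obtain ⟨g', rfl⟩ := (Ext.mk₀_bijective _ _).2 e'
        exact ⟨Ext.mk₀ (adj.homEquiv X N g'), by rw [h0, Equiv.symm_apply_apply]⟩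
    | succ k ih =>
      intro X
      let P : ProjectivePresentation X := Classical.arbitrary _
      let S := ShortComplex.mk _ _ (kernel.condition P.f)
      have : Projective (S.map F).X₂ :=
        Functor.PreservesProjectiveObjects.projective_obj (F := F) P.projective
      have hS : S.ShortExact := { exact := ShortComplex.exact_kernel P.f }
      refine AddMonoidHom.bijective_of_surjective_of_bijective_of_right_exact _ _ _ _
        (Φ k S.X₂) (Φ k S.X₁) (Φ (k + 1) S.X₃) ?_ ?_
        ((ShortComplex.ab_exact_iff_function_exact _).1
          (Ext.contravariant_sequence_exact₁' hS _ k (k + 1) (add_comm 1 k)))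
        ((ShortComplex.ab_exact_iff_function_exact _).1
          (Ext.contravariant_sequence_exact₁' (hS.map_of_exact F) N k (k + 1) (add_comm 1 k)))
        (ih _).surjective (ih _)
        (fun x₃ => Ext.contravariant_sequence_exact₃ hS _ x₃ (Ext.eq_zero_of_projective _)
          (add_comm 1 k))
        (fun y₃ => Ext.contravariant_sequence_exact₃ (hS.map_of_exact F) _ y₃
          (Ext.eq_zero_of_projective _) (add_comm 1 k))
      · ext e
        exact (hnat k _ _ S.f e).symm
      · ext e
        exact (hδ hS k e).symm
  refine ⟨Φ n, hbij n, fun X c e => ?_, hnat n, fun X g e => ?_⟩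
  swap
  · -- naturality in `N` (endomorphisms): the counit is natural
    rw [hΦ, hΦ, Ext.mapExactFunctor_comp, Ext.mapExactFunctor_mk₀, Ext.comp_assoc_of_third_deg_zero,
      Ext.mk₀_comp_mk₀, Ext.comp_assoc_of_third_deg_zero, Ext.mk₀_comp_mk₀]
    congr 2
    exact adj.counit.naturality g
  -- scalars: `c • e = mk₀ (c • 𝟙) ∘ e` and `F (c • 𝟙) = f c • 𝟙`
  rw [show c • e = (Ext.mk₀ (c • 𝟙 X)).comp e (zero_add n) by
      rw [Ext.mk₀_smul, Ext.smul_comp, Ext.mk₀_id_comp],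
    hnat, extendScalars_map_smul_id, Ext.mk₀_smul, Ext.smul_comp, Ext.mk₀_id_comp]

/-- **Annihilator transfer along a flat base change** (THEOREM-A §1's «`E_m = Extᵐ_A(M, N) =
Extᵐ_R(M[u], N)`» in the only direction the corollaries need): if `c : A` kills
`Extⁿ_A(X, N|_A)` then `f c` kills `Extⁿ_R(R ⊗_A X, N)`. [folklore] -/
theorem smul_ext_eq_zero_of_flat_baseChange (hf : f.Flat) {X : ModuleCat.{u} A}
    {N : ModuleCat.{u} R} {n : ℕ} {c : A}
    (hc : ∀ e : Ext.{u} X ((ModuleCat.restrictScalars.{u, u, u} f).obj N) n, c • e = 0)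
    (e : Ext.{u} ((ModuleCat.extendScalars.{u, u, u} f).obj X) N n) : f c • e = 0 := by
  obtain ⟨Φ, hbij, hsmul, -, -⟩ := exists_extBaseChange f hf N n
  obtain ⟨e₀, rfl⟩ := (hbij X).2 e
  rw [← hsmul, hc, map_zero]

end BaseChange

/-! ## Bridges to the `Algebra` / `IsScalarTower` vocabulary -/

section Bridge

variable {A R : Type u} [CommRing A] [CommRing R] [Algebra A R]

/-- `N|_A` two ways: a module carrying compatible `A`- and `R`-structures IS its restriction of
scalars (the identity map is an isomorphism in `ModuleCat A`). -/
theorem nonempty_iso_restrictScalars (N : Type u) [AddCommGroup N] [Module A N] [Module R N]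
    [IsScalarTower A R N] :
    Nonempty (ModuleCat.of A N ≅
      (ModuleCat.restrictScalars.{u, u, u} (algebraMap A R)).obj (ModuleCat.of R N)) := by
  let e : N ≃ₗ[A] ((ModuleCat.restrictScalars.{u, u, u} (algebraMap A R)).obj (ModuleCat.of R N)) :=
    { toFun := fun x => x
      map_add' := fun _ _ => rfl
      map_smul' := fun a x => (algebraMap_smul R a x).symm
      invFun := fun x => x
      left_inv := fun _ => rfl
      right_inv := fun _ => rfl }
  exact ⟨e.toModuleIso⟩

set_option backward.isDefEq.respectTransparency false in
/-- `R ⊗_A X` two ways: the tensor product for the `Algebra A R` structure is isomorphic, in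
`ModuleCat R`, to Mathlib's `(extendScalars (algebraMap A R)).obj X` (the identity on pure
tensors). -/
theorem nonempty_iso_extendScalars (X : Type u) [AddCommGroup X] [Module A X] :
    Nonempty (ModuleCat.of R (R ⊗[A] X) ≅
      (ModuleCat.extendScalars.{u, u, u} (algebraMap A R)).obj (ModuleCat.of A X)) := by
  let R' := (ModuleCat.restrictScalars.{u, u, u} (algebraMap A R)).obj (ModuleCat.of R R)
  let e : R ≃ₗ[A] R' :=
    { toFun := fun x => x
      map_add' := fun _ _ => rfl
      map_smul' := fun a x => Algebra.smul_def a x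
      invFun := fun x => x
      left_inv := fun _ => rfl
      right_inv := fun _ => rfl }
  let ψ : R ⊗[A] X ≃ₗ[A] R' ⊗[A] X := TensorProduct.congr e (LinearEquiv.refl A X)
  have hψ : ∀ (r : R) (x : X), ψ (r ⊗ₜ x) = (e r) ⊗ₜ x := fun r x => rfl
  have hsmul : ∀ (r : R) (z : R ⊗[A] X),
      ψ (r • z) = (r • ψ z :
        (ModuleCat.extendScalars.{u, u, u} (algebraMap A R)).obj (ModuleCat.of A X)) := by
    intro r z
    induction z using TensorProduct.induction_on with
    | zero => rw [smul_zero, map_zero, smul_zero]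
    | tmul s x =>
      rw [TensorProduct.smul_tmul', hψ, smul_eq_mul, hψ]
      rfl
    | add z w hz hw => rw [smul_add, map_add, hz, hw, map_add, smul_add]
  let Ψ : R ⊗[A] X ≃ₗ[R]
      (ModuleCat.extendScalars.{u, u, u} (algebraMap A R)).obj (ModuleCat.of A X) :=
    { ψ with map_smul' := hsmul }
  exact ⟨Ψ.toModuleIso⟩

end Bridge

/-! ## The transfer for a flat algebra, in `Algebra` vocabulary -/

section FlatAlgebra

variable {A R : Type u} [CommRing A] [CommRing R] [Algebra A R] [Module.Flat A R]

/-- **Annihilator transfer along a flat algebra.** For `R` a flat `A`-algebra, an `A`-module `X`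
and an `R`-module `N`: if `c : A` kills `Extⁿ_A(X, N|_A)` (with `N|_A = restrictScalars`), then
`algebraMap A R c` kills `Extⁿ_R(R ⊗[A] X, N)`. [folklore] -/
theorem smul_ext_eq_zero_of_flat {X : Type u} [AddCommGroup X] [Module A X] {N : ModuleCat.{u} R}
    {n : ℕ} {c : A}
    (hc : ∀ e : Ext.{u} (ModuleCat.of A X)
      ((ModuleCat.restrictScalars.{u, u, u} (algebraMap A R)).obj N) n, c • e = 0)
    (e : Ext.{u} (ModuleCat.of R (R ⊗[A] X)) N n) : algebraMap A R c • e = 0 := by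
  have hf : (algebraMap A R).Flat := RingHom.flat_algebraMap_iff.mpr inferInstance
  obtain ⟨ι⟩ := nonempty_iso_extendScalars (A := A) (R := R) X
  exact smul_ext_eq_zero_of_iso₁ ι (smul_ext_eq_zero_of_flat_baseChange (algebraMap A R) hf hc) e

/-- The same with the coefficients given as a module `N` carrying compatible `A`- and
`R`-structures (`[IsScalarTower A R N]`): `c` kills `Extⁿ_A(X, N)` ⇒ `algebraMap A R c` kills
`Extⁿ_R(R ⊗[A] X, N)`. [folklore] -/
theorem smul_ext_eq_zero_of_flat' {X : Type u} [AddCommGroup X] [Module A X] {N : Type u}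
    [AddCommGroup N] [Module A N] [Module R N] [IsScalarTower A R N] {n : ℕ} {c : A}
    (hc : ∀ e : Ext.{u} (ModuleCat.of A X) (ModuleCat.of A N) n, c • e = 0)
    (e : Ext.{u} (ModuleCat.of R (R ⊗[A] X)) (ModuleCat.of R N) n) :
    algebraMap A R c • e = 0 := by
  obtain ⟨κ⟩ := nonempty_iso_restrictScalars (A := A) (R := R) N
  refine smul_ext_eq_zero_of_flat (fun e' => ?_) e
  exact smul_ext_eq_zero_of_iso₂ κ.symm hc e'

end FlatAlgebra

end Summit.ResolutionOfSingularities.ResolutionOfSingularities.Theorems.HomologicalConductor.PersistenceExtFlatBaseChange
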